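import Summits.QuantumFields.BalabanUV.Beta.FP.KernelStepDressing

/-!
# `BalabanUV.Beta.FP.KernelStepDressingHessKer` — road «FP», binder row D1, ROUTE T (β1), (H5-F) proper, FILE 2: **THE RESOLVENT HESSIAN KERNEL OF
# THE STEP-DRESSED FAMILIES IS THE TWO-SIDED DRESSED KERNEL OF THE UNDRESSED ONE** —
# `hessKer A (dressV N L w V) (dressW N L w W) μ ν z = dressedEntry w (hessKer A V W) (L•z) μ ν`
# (v10's `htr` shape `hessKer (AF (j+1)) (𝒱F (j+1)) (𝒲F (j+1)) μ ν z = Lc⁸ · dressedEntry (wStep Lc (j+1)) (hessKer (AN j) (VN j) (WN j)) (Lc•z) μ ν`, the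
# `Lc⁸` being `Lc⁴` per dressed vertex ∕ `Lc⁸` on the dressed bi-vertex — bubble bilinear, tadpole linear)

WHY (located).  an2 g79 J-NOTE-23 proper §3 (H5-F) ∕ (H6): «`htr`'s shape … what the tree LACKS is the kernel-level dressing»; road g57 SPEC-64 §17 (2) (H5-F);
road g58 A-2 l.68977 (c).  FILE 1 (`KernelStepDressing`) defined `dressV ∕ dressW` and proved their localisation and covariance.  THIS FILE proves the identity,
for a spread leg `A` invariant under the `N`-block translations, `N`-block covariant families `V` (first order, bi-localised at their coarse points) and `W`
(second order, jointly covariant), and a column kernel `w` whose entries decay from the origin: the bubble of two dressed vertices and the tadpole of the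
dressed bi-vertex are the absolutely convergent double lattice sums of the undressed ones (leaf-01 `DressedBubbleBridge.bubble_wsum_wsum`,
`DressedTadpoleTable.tadpole_wsum_wsum` on an4's extensions by zero `InterLevelTransport.onLat`), covariance makes the undressed tables functions of the
difference `t′ − t` (`bubble_shiftK ∕ tadpole_shiftK`), and the change of variables `(u, x) = (−t, L•z − t′)` is `DecimatedMomentSummable.dressedSum`'s.

WHAT ([folklore] lattice-sum bookkeeping; no `def`, no `def … : Prop`, nothing cited, 0 sorry).
* §1 helpers: MKer-level sum forms of `dressV ∕ dressW`; `onLat` through an inner superposition; the product re-indexing `tsum_prod_onLat`; covariance of the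
  undressed bubble ∕ tadpole tables (`bubble_cov ∕ tadpole_cov`); uniform bounds and summability of the weighted tables.
* §2 **`bubble_dressV_dressV`**, **`tadpole_dressW`** — the two halves as `Σ_{c,e} Σ'_{(t,t′)} w c μ (−t) · w e ν (L•z − t′) · (table at t′ − t)`.
* §3 **`hessKer_dressV_dressW`** — the identity.
WHAT THIS IS NOT: not an instantiation at `(AN j, VN j, WN j, wStep Lc (j+1))` (the END's; needs an2's covariance ∕ invariance letters of `AN VN WN` and the decay of
`wStep`'s entries by name — all in the tree, to be junctioned in FILE 3 with v10's `htr` text CHARACTER FOR CHARACTER); not `hF₁` (the depth-1 literal anchor); nothing of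
Bałaban's asserted, valued or discharged; 0 estimates; 0∕4 row-D1 binders; NOT (C1), NOT D1, NEVER «G-an2-4 closed», NOT BetaPertH, NOT continuum, NOT Clay.
HONEST DEPENDENCY (page 1, mandatory): continuum YM on T⁴ ⇐ BetaPertH ∧ nine spine estimates (0/9 proved); BetaPertH ⇐ (D1) ∧ (D4) ∧ CAP+tail;
G-an2-4 gates asym, D1 and NE2/3/4.  HONEST FRAMING (cell contract, verbatim): «discharging `BetaPertH` makes Bałaban's UV stability UNCONDITIONAL —
a real constructive-QFT result; it is NOT the continuum limit and NOT the Clay problem.»  ABSOLUTE RULE (cell charter, verbatim): «No internally-minted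
statement may enter as a cited fact. Every hypothesis is either kernel-proved in this package or a verbatim quotation of a PUBLISHED theorem with page
reference. The manuscript(s) under audit are NOT citable for their own disputed steps — they are the thing under adjudication; programme-internal
(2001/route/tribunal) claims are never citable.»  Road «FP» OWNER, b2b-balaban-beta-d1-p3 gen 58, 2026-08-29.  No existing file touched.
-/

noncomputable section

open scoped BigOperators

namespace Summit.QuantumFields.BalabanUV.Beta.FP.KernelStepDressingHessKer

open Finset
open Literature.Probability.LatticeModels (Torus.proj)
open Literature.MathematicalPhysics.QuantumFieldTheory
open Literature.MathematicalPhysics.QuantumFieldTheory.Balaban1983to89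
open Literature.MathematicalPhysics.QuantumFieldTheory.Balaban1983to89.Beta
open B12Sec2to5 (l1 l1_nonneg)
open ExpKernelCalculus (Site MKer Decays BiLoc VertexFamily VertexFamily₂ shiftK Zl Zl_nonneg l1_natSmul l1_sub_symm hessKer bubble tadpole
  bubble_shiftK tadpole_shiftK abs_bubble_le abs_tadpole_le summable_exp_shift')
open LatticeForm (quo)
open DecimatedMomentSummable (dressedSum)
open DressedMomentNormalisation (EKer dressedEntry)
open OneStepResolventKernel (Fib wsum eq_zsmul_quo_of_proj quo_zsmul)
open InterLevelTransport (onLat onLat_zsmul onLat_off cwsum cwsum_apply)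
open Summit.QuantumFields.BalabanUV.Beta.TameKernelCalculus (Spr Loc biLoc_of_le decays_of_le)
open Summit.QuantumFields.BalabanUV.Beta.KernelWardRelative (loc_finset_sum tadpole_finset_sum bubble_finset_sum_left)
open Summit.QuantumFields.BalabanUV.Beta.D1BFx.DressedBubbleBridge (summable_abs_of_expWeight loc_wsum bubble_finset_sum_right bubble_wsum_wsum)
open Summit.QuantumFields.BalabanUV.Beta.D1BFx.DressedTadpoleTable (tadpole_wsum_wsum biLoc_wsum_fst biLoc_wsum_snd)
open Summit.QuantumFields.BalabanUV.Beta.FP.MixVertexLimit (abs_onLat_le)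
open Summit.QuantumFields.BalabanUV.Beta.FP.ResponseVertexLipschitz (biLoc_onLat_self)
open Summit.QuantumFields.BalabanUV.Beta.FP.KernelStepDressing

variable {d : ℕ} {N : ℕ} [NeZero N]

/-! ## §1 Helpers -/

section Helpers

variable (N) (L : ℕ) (w : EKer (d + 1)) (V : Fin (d + 1) → Site (d + 1) → MKer (d + 1) (Fib d))
  (W : Fin (d + 1) → Site (d + 1) → Fin (d + 1) → Site (d + 1) → MKer (d + 1) (Fib d))

omit [NeZero N] in
/-- [folklore] `dressV` as a sum of kernels. -/
theorem dressV_eq_sum (μ : Fin (d + 1)) (z : Site (d + 1)) :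
    dressV N L w V μ z = ∑ c : Fin (d + 1), cwsum N (fun t => w c μ ((L : ℤ) • z - t)) (V c) := by
  funext x y a b
  simp only [dressV, Finset.sum_apply]

omit [NeZero N] in
/-- [folklore] `dressW` as a double sum of kernels. -/
theorem dressW_eq_sum (μ : Fin (d + 1)) (z : Site (d + 1)) (ν : Fin (d + 1)) (z' : Site (d + 1)) :
    dressW N L w W μ z ν z' = ∑ c : Fin (d + 1), ∑ e : Fin (d + 1),
      cwsum N (fun t => w c μ ((L : ℤ) • z - t)) (fun t => cwsum N (fun t' => w e ν ((L : ℤ) • z' - t')) (W c t e)) := by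
  funext x y a b
  simp only [dressW, Finset.sum_apply]

variable {N L w V W}

/-- [folklore] The superposition of the zero family vanishes (twin of leaf BF-x `D1BFx/GhostDeficitFormula.wsum_zero_family`, kept local to spare a 621-module import —
chair leaf-03 g66 C-4 DOCFIX-1 (iii)). -/
theorem wsum_zero_family (g : Site (d + 1) → ℝ) : wsum g (fun _ => (0 : MKer (d + 1) (Fib d))) = 0 := by
  funext x y a b
  simp only [OneStepResolventKernel.wsum, Pi.zero_apply, mul_zero, tsum_zero]

/-- [folklore] **EXTENSION BY ZERO THROUGH AN INNER SUPERPOSITION**: `onLat N (t ↦ Σ'_{u′} g u′ • K t u′) u = Σ'_{u′} g u′ • onLat N (t ↦ K t u′) u`. -/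
theorem onLat_wsum (g : Site (d + 1) → ℝ) (K : Site (d + 1) → Site (d + 1) → MKer (d + 1) (Fib d)) (u : Site (d + 1)) :
    onLat N (fun t => wsum g (K t)) u = wsum g (fun u' => onLat N (fun t => K t u') u) := by
  by_cases hu : Torus.proj N u = 0
  · have e := eq_zsmul_quo_of_proj (N := N) hu
    rw [e]
    simp only [onLat_zsmul]
  · rw [onLat_off _ hu]
    have hz : (fun u' => onLat N (fun t => K t u') u) = fun _ => (0 : MKer (d + 1) (Fib d)) := funext fun u' => onLat_off _ hu
    rw [hz, wsum_zero_family]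

/-- [folklore] **RE-INDEXING A PRODUCT LATTICE SUM SUPPORTED ON `(N•ℤ^{d+1})²`** along `(t, t′) ↦ (N•t, N•t′)`. -/
theorem tsum_prod_onLat (f g : Site (d + 1) → ℝ) (H : Site (d + 1) → Site (d + 1) → ℝ) :
    ∑' q : Site (d + 1) × Site (d + 1), onLat N f q.1 * onLat N g q.2 * H q.1 q.2
      = ∑' p : Site (d + 1) × Site (d + 1), f p.1 * g p.2 * H ((N : ℤ) • p.1) ((N : ℤ) • p.2) := by
  have hinj : Function.Injective (fun p : Site (d + 1) × Site (d + 1) => (((N : ℤ) • p.1, (N : ℤ) • p.2) : Site (d + 1) × Site (d + 1))) := by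
    intro p p' h
    simp only [Prod.mk.injEq] at h
    have h1 := congrArg (quo N) h.1
    have h2 := congrArg (quo N) h.2
    simp only [quo_zsmul] at h1 h2
    exact Prod.ext h1 h2
  rw [← hinj.tsum_eq (f := fun q : Site (d + 1) × Site (d + 1) => onLat N f q.1 * onLat N g q.2 * H q.1 q.2)]
  · exact tsum_congr fun p => by simp only [onLat_zsmul]
  · intro q hq
    by_cases h1 : Torus.proj N q.1 = 0
    · by_cases h2 : Torus.proj N q.2 = 0
      · exact ⟨(quo N q.1, quo N q.2), Prod.ext (eq_zsmul_quo_of_proj (N := N) h1).symm (eq_zsmul_quo_of_proj (N := N) h2).symm⟩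
      · refine (Function.mem_support.mp hq ?_).elim
        show onLat N f q.1 * onLat N g q.2 * H q.1 q.2 = 0
        rw [onLat_off g h2, mul_zero, zero_mul]
    · refine (Function.mem_support.mp hq ?_).elim
      show onLat N f q.1 * onLat N g q.2 * H q.1 q.2 = 0
      rw [onLat_off f h1, zero_mul, zero_mul]

omit [NeZero N] in
/-- [folklore] **COVARIANCE OF THE UNDRESSED BUBBLE TABLE**: for an `N`-block invariant leg and an `N`-block covariant family,
`bubble A (V c t) (V e t′) = bubble A (V c 0) (V e (t′ − t))`. -/
theorem bubble_cov {A : MKer (d + 1) (Fib d)} (hAN : ∀ s : Site (d + 1), shiftK ((N : ℤ) • s) A = A)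
    (hV : ∀ (c : Fin (d + 1)) (t s : Site (d + 1)), V c (t + s) = shiftK (-((N : ℤ) • s)) (V c t)) (c e : Fin (d + 1)) (t t' : Site (d + 1)) :
    bubble A (V c t) (V e t') = bubble A (V c 0) (V e (t' - t)) := by
  have h1 : V c t = shiftK (-((N : ℤ) • t)) (V c 0) := by rw [← hV c 0 t, zero_add]
  have h2 : V e t' = shiftK (-((N : ℤ) • t)) (V e (t' - t)) := by rw [← hV e (t' - t) t, sub_add_cancel]
  have h3 : A = shiftK (-((N : ℤ) • t)) A := by rw [← smul_neg]; exact (hAN (-t)).symm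
  rw [h1, h2]
  conv_lhs => rw [h3]
  exact bubble_shiftK _ _ _ _

omit [NeZero N] in
/-- [folklore] **COVARIANCE OF THE UNDRESSED TADPOLE TABLE**: `tadpole A (W c t e t′) = tadpole A (W c 0 e (t′ − t))`. -/
theorem tadpole_cov {A : MKer (d + 1) (Fib d)} (hAN : ∀ s : Site (d + 1), shiftK ((N : ℤ) • s) A = A)
    (hW : ∀ (c : Fin (d + 1)) (t : Site (d + 1)) (e : Fin (d + 1)) (t' s : Site (d + 1)),
      W c (t + s) e (t' + s) = shiftK (-((N : ℤ) • s)) (W c t e t')) (c e : Fin (d + 1)) (t t' : Site (d + 1)) :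
    tadpole A (W c t e t') = tadpole A (W c 0 e (t' - t)) := by
  have h1 : W c t e t' = shiftK (-((N : ℤ) • t)) (W c 0 e (t' - t)) := by rw [← hW c 0 e (t' - t) t, zero_add, sub_add_cancel]
  have h3 : A = shiftK (-((N : ℤ) • t)) A := by rw [← smul_neg]; exact (hAN (-t)).symm
  rw [h1]
  conv_lhs => rw [h3]
  exact tadpole_shiftK _ _ _

/-- [folklore] A column weight decaying from `0`, read at `c₀ − t`, decays from `c₀`; it is absolutely summable. -/
theorem abs_col_le {w : EKer (d + 1)} {Cw δw : ℝ} (hw : ∀ c a u, |w c a u| ≤ Cw * Real.exp (-δw * l1 u)) (c a : Fin (d + 1))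
    (c₀ t : Site (d + 1)) : |w c a (c₀ - t)| ≤ Cw * Real.exp (-δw * l1 (t - c₀)) := by
  rw [l1_sub_symm]; exact hw c a _

end Helpers

/-! ## §2 The two halves -/

section Halves

variable (L : ℕ) {w : EKer (d + 1)} {Cw δw : ℝ} {A : MKer (d + 1) (Fib d)}
  {V : Fin (d + 1) → Site (d + 1) → MKer (d + 1) (Fib d)} {Cv δ : ℝ}
  {W : Fin (d + 1) → Site (d + 1) → Fin (d + 1) → Site (d + 1) → MKer (d + 1) (Fib d)} {C2 : ℝ}

/-- [folklore] **THE BUBBLE OF TWO DRESSED VERTICES**: `bubble A (dressV … a 0) (dressV … b z) = Σ_{c,e} Σ'_{(t,t′)} w c a (−t) · w e b (L•z − t′) · bubble A (V c 0) (V e (t′ − t))`. -/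
theorem bubble_dressV_dressV (hA : Spr A) (hAN : ∀ s : Site (d + 1), shiftK ((N : ℤ) • s) A = A)
    (hw : ∀ c a u, |w c a u| ≤ Cw * Real.exp (-δw * l1 u)) (hCw : 0 ≤ Cw) (hδw : 0 < δw)
    (hV : VertexFamily V N Cv δ) (hδ : 0 < δ)
    (hVcov : ∀ (c : Fin (d + 1)) (t s : Site (d + 1)), V c (t + s) = shiftK (-((N : ℤ) • s)) (V c t))
    (a b : Fin (d + 1)) (z : Site (d + 1)) :
    bubble A (dressV N L w V a 0) (dressV N L w V b z)
      = ∑ c : Fin (d + 1), ∑ e : Fin (d + 1), ∑' p : Site (d + 1) × Site (d + 1),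
          w c a (-p.1) * w e b ((L : ℤ) • z - p.2) * bubble A (V c 0) (V e (p.2 - p.1)) := by
  have hNpos : (0 : ℝ) < N := by exact_mod_cast Nat.pos_of_ne_zero (NeZero.ne N)
  set m : ℝ := min (δw / N) δ with hm_def
  have hm : 0 < m := lt_min (div_pos hδw hNpos) hδ
  have hCv : 0 ≤ |Cv| := abs_nonneg _
  -- lifted weights and families
  have hwt : ∀ (c a' : Fin (d + 1)) (zz : Site (d + 1)) (u : Site (d + 1)),
      |onLat N (fun t => w c a' ((L : ℤ) • zz - t)) u| ≤ Cw * Real.exp (-m * l1 (u - (N : ℤ) • ((L : ℤ) • zz))) := by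
    intro c a' zz u
    refine abs_onLat_le (N := N) (fun t => ?_) u
    refine (abs_colWeight_le (N := N) hw L c a' zz t).trans (mul_le_mul_of_nonneg_left (Real.exp_le_exp.2 ?_) hCw)
    nlinarith [l1_nonneg ((N : ℤ) • t - (N : ℤ) • ((L : ℤ) • zz)), min_le_left (δw / N) δ]
  have hVl : ∀ (c : Fin (d + 1)) (u : Site (d + 1)), BiLoc (onLat N (V c) u) u u (|Cv|) m :=
    fun c u => biLoc_onLat_self (N := N) (fun t => biLoc_of_le (hV c t) (min_le_right _ _)) u
  have hloc : ∀ (c a' : Fin (d + 1)) (zz : Site (d + 1)), Loc (cwsum N (fun t => w c a' ((L : ℤ) • zz - t)) (V c)) :=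
    fun c a' zz => loc_wsum (hwt c a' zz) hCw (hVl c) hm
  rw [dressV_eq_sum, dressV_eq_sum, bubble_finset_sum_left Finset.univ hA (fun c => hloc c a 0) (loc_finset_sum _ fun e => hloc e b z)]
  refine Finset.sum_congr rfl fun c _ => ?_
  rw [bubble_finset_sum_right Finset.univ hA (hloc c a 0) (fun e => hloc e b z)]
  refine Finset.sum_congr rfl fun e _ => ?_
  unfold InterLevelTransport.cwsum
  refine (bubble_wsum_wsum hA (hwt c a 0) hm (hwt e b z) hCw hm (hVl c) (hVl e) hm).trans ?_
  refine (tsum_prod_onLat (N := N) (fun t => w c a ((L : ℤ) • (0 : Site (d + 1)) - t)) (fun t' => w e b ((L : ℤ) • z - t'))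
    (fun u u' => bubble A (onLat N (V c) u) (onLat N (V e) u'))).trans ?_
  refine tsum_congr fun p => ?_
  show w c a ((L : ℤ) • (0 : Site (d + 1)) - p.1) * w e b ((L : ℤ) • z - p.2)
      * bubble A (onLat N (V c) ((N : ℤ) • p.1)) (onLat N (V e) ((N : ℤ) • p.2)) = _
  rw [onLat_zsmul, onLat_zsmul, smul_zero, zero_sub, bubble_cov (N := N) hAN hVcov c e p.1 p.2]

/-- [folklore] **THE TADPOLE OF THE DRESSED BI-VERTEX**: `tadpole A (dressW … a 0 b z) = Σ_{c,e} Σ'_{(t,t′)} w c a (−t) · w e b (L•z − t′) · tadpole A (W c 0 e (t′ − t))`. -/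
theorem tadpole_dressW (hA : Spr A) (hAN : ∀ s : Site (d + 1), shiftK ((N : ℤ) • s) A = A)
    (hw : ∀ c a u, |w c a u| ≤ Cw * Real.exp (-δw * l1 u)) (hCw : 0 ≤ Cw) (hδw : 0 < δw)
    (hW : VertexFamily₂ W N C2 δ) (hδ : 0 < δ)
    (hWcov : ∀ (c : Fin (d + 1)) (t : Site (d + 1)) (e : Fin (d + 1)) (t' s : Site (d + 1)),
      W c (t + s) e (t' + s) = shiftK (-((N : ℤ) • s)) (W c t e t'))
    (a b : Fin (d + 1)) (z : Site (d + 1)) :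
    tadpole A (dressW N L w W a 0 b z)
      = ∑ c : Fin (d + 1), ∑ e : Fin (d + 1), ∑' p : Site (d + 1) × Site (d + 1),
          w c a (-p.1) * w e b ((L : ℤ) • z - p.2) * tadpole A (W c 0 e (p.2 - p.1)) := by
  have hNpos : (0 : ℝ) < N := by exact_mod_cast Nat.pos_of_ne_zero (NeZero.ne N)
  set m : ℝ := min (δw / N) δ with hm_def
  have hm : 0 < m := lt_min (div_pos hδw hNpos) hδ
  have hC2 : 0 ≤ |C2| := abs_nonneg _
  have hwt : ∀ (c a' : Fin (d + 1)) (zz : Site (d + 1)) (u : Site (d + 1)),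
      |onLat N (fun t => w c a' ((L : ℤ) • zz - t)) u| ≤ Cw * Real.exp (-m * l1 (u - (N : ℤ) • ((L : ℤ) • zz))) := by
    intro c a' zz u
    refine abs_onLat_le (N := N) (fun t => ?_) u
    refine (abs_colWeight_le (N := N) hw L c a' zz t).trans (mul_le_mul_of_nonneg_left (Real.exp_le_exp.2 ?_) hCw)
    nlinarith [l1_nonneg ((N : ℤ) • t - (N : ℤ) • ((L : ℤ) • zz)), min_le_left (δw / N) δ]
  -- the doubly-lifted bi-vertex family
  have hW' : ∀ (c e : Fin (d + 1)) (u u' : Site (d + 1)),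
      BiLoc (onLat N (fun t => onLat N (W c t e) u') u) u u' (|C2|) m := by
    intro c e u u'
    refine biLoc_onLat_fst (N := N) hC2 (fun t => ?_) u
    exact biLoc_onLat_snd (N := N) hC2 (fun t' => biLoc_of_le (hW c t e t') (min_le_right _ _)) u'
  -- each summand in the `wsum (lifted weight) (u ↦ wsum (lifted weight) (W″ u))` form, and its localisation
  have hform : ∀ (c e : Fin (d + 1)),
      cwsum N (fun t => w c a ((L : ℤ) • (0 : Site (d + 1)) - t)) (fun t => cwsum N (fun t' => w e b ((L : ℤ) • z - t')) (W c t e))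
        = wsum (onLat N (fun t => w c a ((L : ℤ) • (0 : Site (d + 1)) - t)))
            (fun u => wsum (onLat N (fun t' => w e b ((L : ℤ) • z - t'))) (fun u' => onLat N (fun t => onLat N (W c t e) u') u)) := by
    intro c e
    unfold InterLevelTransport.cwsum
    congr 1
    funext u
    exact onLat_wsum (N := N) _ (fun t u' => onLat N (W c t e) u') u
  have hCin : 0 ≤ Cw * |C2| * Zl (d + 1) (m / 2) := mul_nonneg (mul_nonneg hCw hC2) (Zl_nonneg (by linarith))
  have hloc : ∀ (c e : Fin (d + 1)), Loc (cwsum N (fun t => w c a ((L : ℤ) • (0 : Site (d + 1)) - t))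
      (fun t => cwsum N (fun t' => w e b ((L : ℤ) • z - t')) (W c t e))) := by
    intro c e
    rw [hform c e]
    have hin : ∀ u, BiLoc (wsum (onLat N (fun t' => w e b ((L : ℤ) • z - t'))) (fun u' => onLat N (fun t => onLat N (W c t e) u') u))
        u ((N : ℤ) • ((L : ℤ) • z)) (Cw * |C2| * Zl (d + 1) (m / 2)) (m / 2) :=
      fun u => biLoc_wsum_snd (hwt e b z) (fun u' => hW' c e u u') hm hCw
    exact ⟨_, _, _, m / 2 / 2, half_pos (half_pos hm),
      biLoc_wsum_fst (p := (N : ℤ) • ((L : ℤ) • (0 : Site (d + 1))))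
        (fun u => show |onLat N (fun t => w c a ((L : ℤ) • (0 : Site (d + 1)) - t)) u|
            ≤ Cw * Real.exp (-(m / 2) * l1 (u - (N : ℤ) • ((L : ℤ) • (0 : Site (d + 1))))) from
          (hwt c a 0 u).trans (mul_le_mul_of_nonneg_left (Real.exp_le_exp.2 (by
            have h0 := mul_nonneg hm.le (l1_nonneg (u - (N : ℤ) • ((L : ℤ) • (0 : Site (d + 1))))); linarith)) hCw))
        hin (half_pos hm) hCw⟩
  rw [dressW_eq_sum, tadpole_finset_sum Finset.univ hA (fun c => loc_finset_sum _ fun e => hloc c e)]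
  refine Finset.sum_congr rfl fun c _ => ?_
  rw [tadpole_finset_sum Finset.univ hA (fun e => hloc c e)]
  refine Finset.sum_congr rfl fun e _ => ?_
  rw [hform c e]
  refine (tadpole_wsum_wsum hA (hwt c a 0) hm (hwt e b z) hCw hm (hW' c e) hm).trans ?_
  refine (tsum_prod_onLat (N := N) (fun t => w c a ((L : ℤ) • (0 : Site (d + 1)) - t)) (fun t' => w e b ((L : ℤ) • z - t'))
    (fun u u' => tadpole A (onLat N (fun t => onLat N (W c t e) u') u))).trans ?_
  refine tsum_congr fun p => ?_
  show w c a ((L : ℤ) • (0 : Site (d + 1)) - p.1) * w e b ((L : ℤ) • z - p.2)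
      * tadpole A (onLat N (fun t => onLat N (W c t e) ((N : ℤ) • p.2)) ((N : ℤ) • p.1)) = _
  rw [onLat_zsmul, onLat_zsmul, smul_zero, zero_sub, tadpole_cov (N := N) hAN hWcov c e p.1 p.2]

end Halves

/-! ## §3 The identity -/

section Identity

variable (L : ℕ) {w : EKer (d + 1)} {Cw δw : ℝ} {A : MKer (d + 1) (Fib d)}
  {V : Fin (d + 1) → Site (d + 1) → MKer (d + 1) (Fib d)} {Cv δ : ℝ}
  {W : Fin (d + 1) → Site (d + 1) → Fin (d + 1) → Site (d + 1) → MKer (d + 1) (Fib d)} {C2 : ℝ}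

/-- [folklore] **THE RESOLVENT HESSIAN KERNEL OF THE STEP-DRESSED FAMILIES IS THE TWO-SIDED DRESSED KERNEL OF THE UNDRESSED ONE**:
`hessKer A (dressV N L w V) (dressW N L w W) a b z = dressedEntry w (hessKer A V W) (L•z) a b`. -/
theorem hessKer_dressV_dressW (hA : Spr A) (hAN : ∀ s : Site (d + 1), shiftK ((N : ℤ) • s) A = A)
    (hw : ∀ c a u, |w c a u| ≤ Cw * Real.exp (-δw * l1 u)) (hCw : 0 ≤ Cw) (hδw : 0 < δw)
    (hV : VertexFamily V N Cv δ) (hW : VertexFamily₂ W N C2 δ) (hδ : 0 < δ)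
    (hVcov : ∀ (c : Fin (d + 1)) (t s : Site (d + 1)), V c (t + s) = shiftK (-((N : ℤ) • s)) (V c t))
    (hWcov : ∀ (c : Fin (d + 1)) (t : Site (d + 1)) (e : Fin (d + 1)) (t' s : Site (d + 1)),
      W c (t + s) e (t' + s) = shiftK (-((N : ℤ) • s)) (W c t e t'))
    (a b : Fin (d + 1)) (z : Site (d + 1)) :
    hessKer A (dressV N L w V) (dressW N L w W) a b z = dressedEntry w (hessKer A V W) ((L : ℤ) • z) a b := by
  -- uniform bounds of the undressed tables at a common rate
  obtain ⟨CA, δA, hδA, hAd⟩ := hA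
  set m : ℝ := min δA δ with hm_def
  have hm : 0 < m := lt_min hδA hδ
  have hAd' : Decays A (|CA|) m := decays_of_le hAd (min_le_left _ _)
  have hCv : 0 ≤ |Cv| := abs_nonneg _
  have hC2 : 0 ≤ |C2| := abs_nonneg _
  -- tadpole bound
  set Bt : ℝ := (Fintype.card (Fib d) : ℝ) * ((Fintype.card (Fib d) : ℝ) * (|CA| * |C2|) * Zl (d + 1) (m - m / 2)) * Zl (d + 1) (m / 2 / 2)
  have hBt : ∀ (c e : Fin (d + 1)) (s : Site (d + 1)), |tadpole A (W c 0 e s)| ≤ Bt := by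
    intro c e s
    refine (abs_tadpole_le hAd' (biLoc_of_le (hW c 0 e s) (min_le_right _ _)) hm).trans ?_
    refine mul_le_of_le_one_right ?_ (Real.exp_le_one_iff.2 ?_)
    · exact mul_nonneg (mul_nonneg (Nat.cast_nonneg _) (mul_nonneg (by positivity) (Zl_nonneg (by linarith)))) (Zl_nonneg (by linarith))
    · nlinarith [l1_nonneg (((N : ℤ) • (0 : Site (d + 1))) - (N : ℤ) • s), hm.le]
  -- bubble bound
  set Bb : ℝ := (Fintype.card (Fib d) : ℝ) * ((Fintype.card (Fib d) : ℝ) * (((Fintype.card (Fib d) : ℝ) * (|CA| * |Cv|) * Zl (d + 1) (m - m / 2)) *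
      ((Fintype.card (Fib d) : ℝ) * (|CA| * |Cv|) * Zl (d + 1) (m - m / 2))) * Zl (d + 1) (m / 2 / 2)) * Zl (d + 1) (m / 2 / 2)
  have hBb : ∀ (c e : Fin (d + 1)) (s : Site (d + 1)), |bubble A (V c 0) (V e s)| ≤ Bb := by
    intro c e s
    have h := abs_bubble_le hAd' (biLoc_of_le (hV c 0) (min_le_right _ _)) (biLoc_of_le (hV e s) (min_le_right _ _)) hm
    refine h.trans ?_
    have hZ1 : 0 ≤ Zl (d + 1) (m - m / 2) := Zl_nonneg (by linarith)
    have hZ2 : 0 ≤ Zl (d + 1) (m / 2 / 2) := Zl_nonneg (by linarith)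
    have hE : Real.exp (-(m / 2 / 2) * l1 (((N : ℤ) • (0 : Site (d + 1))) - (N : ℤ) • s)) ≤ 1 :=
      Real.exp_le_one_iff.2 (by nlinarith [l1_nonneg (((N : ℤ) • (0 : Site (d + 1))) - (N : ℤ) • s), hm.le])
    have hX : 0 ≤ (Fintype.card (Fib d) : ℝ) * (((Fintype.card (Fib d) : ℝ) * (|CA| * |Cv|) * Zl (d + 1) (m - m / 2)) *
        ((Fintype.card (Fib d) : ℝ) * (|CA| * |Cv|) * Zl (d + 1) (m - m / 2))) * Zl (d + 1) (m / 2 / 2) := by positivity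
    calc (Fintype.card (Fib d) : ℝ) * ((Fintype.card (Fib d) : ℝ) * (((Fintype.card (Fib d) : ℝ) * (|CA| * |Cv|) * Zl (d + 1) (m - m / 2)) *
          ((Fintype.card (Fib d) : ℝ) * (|CA| * |Cv|) * Zl (d + 1) (m - m / 2))) * Zl (d + 1) (m / 2 / 2) *
          Real.exp (-(m / 2 / 2) * l1 (((N : ℤ) • (0 : Site (d + 1))) - (N : ℤ) • s))) * Zl (d + 1) (m / 2 / 2) *
          Real.exp (-(m / 2 / 2) * l1 (((N : ℤ) • (0 : Site (d + 1))) - (N : ℤ) • s))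
        ≤ (Fintype.card (Fib d) : ℝ) * ((Fintype.card (Fib d) : ℝ) * (((Fintype.card (Fib d) : ℝ) * (|CA| * |Cv|) * Zl (d + 1) (m - m / 2)) *
          ((Fintype.card (Fib d) : ℝ) * (|CA| * |Cv|) * Zl (d + 1) (m - m / 2))) * Zl (d + 1) (m / 2 / 2) * 1) * Zl (d + 1) (m / 2 / 2) * 1 := by
          gcongr
      _ = Bb := by ring
  -- summability of the weighted tables over `ℤ^{d+1} × ℤ^{d+1}`
  have hwa : ∀ c a' : Fin (d + 1), Summable fun t : Site (d + 1) => |w c a' (-t)| := fun c a' =>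
    summable_abs_of_expWeight (p := 0) (fun t => by have h := abs_col_le hw c a' 0 t; rwa [zero_sub] at h) hδw
  have hwb : ∀ e b' : Fin (d + 1), Summable fun t' : Site (d + 1) => |w e b' ((L : ℤ) • z - t')| := fun e b' =>
    summable_abs_of_expWeight (p := (L : ℤ) • z) (fun t' => abs_col_le hw e b' _ t') hδw
  have hsumT : ∀ c e : Fin (d + 1), Summable fun p : Site (d + 1) × Site (d + 1) =>
      w c a (-p.1) * w e b ((L : ℤ) • z - p.2) * tadpole A (W c 0 e (p.2 - p.1)) := by
    intro c e
    refine Summable.of_norm_bounded (((hwa c a).mul_of_nonneg (hwb e b) (fun _ => abs_nonneg _) (fun _ => abs_nonneg _)).mul_right Bt) (fun p => ?_)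
    rw [Real.norm_eq_abs, abs_mul, abs_mul]
    exact mul_le_mul_of_nonneg_left (hBt c e _) (mul_nonneg (abs_nonneg _) (abs_nonneg _))
  have hsumB : ∀ c e : Fin (d + 1), Summable fun p : Site (d + 1) × Site (d + 1) =>
      w c a (-p.1) * w e b ((L : ℤ) • z - p.2) * bubble A (V c 0) (V e (p.2 - p.1)) := by
    intro c e
    refine Summable.of_norm_bounded (((hwa c a).mul_of_nonneg (hwb e b) (fun _ => abs_nonneg _) (fun _ => abs_nonneg _)).mul_right Bb) (fun p => ?_)
    rw [Real.norm_eq_abs, abs_mul, abs_mul]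
    exact mul_le_mul_of_nonneg_left (hBb c e _) (mul_nonneg (abs_nonneg _) (abs_nonneg _))
  -- the left side: the two halves
  have hSpr : Spr A := ⟨CA, δA, hδA, hAd⟩
  rw [ExpKernelCalculus.hessKer, tadpole_dressW (N := N) L hSpr hAN hw hCw hδw hW hδ hWcov a b z,
    bubble_dressV_dressV (N := N) L hSpr hAN hw hCw hδw hV hδ hVcov a b z]
  -- the right side: the change of variables `(u, x) = (−t, L•z − t′)`
  unfold dressedEntry dressedSum
  rw [Finset.mul_sum, Finset.mul_sum, ← Finset.sum_sub_distrib]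
  refine Finset.sum_congr rfl fun c _ => ?_
  rw [Finset.mul_sum, Finset.mul_sum, ← Finset.sum_sub_distrib]
  refine Finset.sum_congr rfl fun e _ => ?_
  let eqv : Site (d + 1) × Site (d + 1) ≃ Site (d + 1) × Site (d + 1) :=
    (Equiv.neg (Site (d + 1))).prodCongr (Equiv.subLeft ((L : ℤ) • z))
  have hterm : ∀ p : Site (d + 1) × Site (d + 1),
      w c a (eqv p).1 * hessKer A V W c e ((L : ℤ) • z + (eqv p).1 - (eqv p).2) * w e b (eqv p).2
        = (1 / 2 : ℝ) * (w c a (-p.1) * w e b ((L : ℤ) • z - p.2) * tadpole A (W c 0 e (p.2 - p.1)))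
          - (1 / 2 : ℝ) * (w c a (-p.1) * w e b ((L : ℤ) • z - p.2) * bubble A (V c 0) (V e (p.2 - p.1))) := by
    intro p
    have e1 : (eqv p).1 = -p.1 := rfl
    have e2 : (eqv p).2 = (L : ℤ) • z - p.2 := rfl
    rw [e1, e2, show (L : ℤ) • z + -p.1 - ((L : ℤ) • z - p.2) = p.2 - p.1 by abel, ExpKernelCalculus.hessKer]
    ring
  have hR : (∑' p : Site (d + 1) × Site (d + 1), w c a p.1 * hessKer A V W c e ((L : ℤ) • z + p.1 - p.2) * w e b p.2)
      = ∑' p : Site (d + 1) × Site (d + 1),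
          ((1 / 2 : ℝ) * (w c a (-p.1) * w e b ((L : ℤ) • z - p.2) * tadpole A (W c 0 e (p.2 - p.1)))
            - (1 / 2 : ℝ) * (w c a (-p.1) * w e b ((L : ℤ) • z - p.2) * bubble A (V c 0) (V e (p.2 - p.1)))) := by
    rw [← eqv.tsum_eq]
    exact tsum_congr hterm
  rw [hR, ((hsumT c e).mul_left (1 / 2 : ℝ)).tsum_sub ((hsumB c e).mul_left (1 / 2 : ℝ)), tsum_mul_left, tsum_mul_left]

end Identity

end Summit.QuantumFields.BalabanUV.Beta.FP.KernelStepDressingHessKer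

end
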